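import Literature.NumberTheory.LFunctions.DirichletXiPairLogDerivSeries
import Literature.NumberTheory.LFunctions.DirichletXiPairMultiplicity
import Literature.NumberTheory.LFunctions.LiCriterionDirichlet
import HarnessLib

/-!
# The pair `Ξ_χ = ξ(·,χ)ξ(·,χ̄)`: the zero-sum identity for the Li functional (Li 2004 Thm 2 in real part)

Topic `Literature/NumberTheory/LFunctions`, sub-namespace `DirichletTheta` (continuation of `DirichletXiPairHadamard.lean`,
`…Zeros.lean`, `…LogDerivSeries.lean`, `…Multiplicity.lean`; the `Ξ_χ`-twin of `keiperLiCoeff_eq_zero_sum_holds`).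
Everything here is PROVED; no definitions.  **RH-FREE and GRH-FREE.**

For a primitive character `χ` mod `q > 1` and `n ≥ 1`:

* `sum_pairs_eq_finsum_add_finsum` — DOUBLE COUNTING: for a Hadamard sequence `b` of `Ξ_χ`, the truncated sum over the pairs
  `Σ_{k : bₖ ≠ 0, |Im ρₖ| ≤ T} [F(ρₖ) + F(1−ρₖ)]` equals `Σ_{ρ ∈ box_χ(T)} m_χ(ρ)F(ρ) + Σ_{ρ ∈ box_χ̄(T)} m_χ̄(ρ)F(ρ)`
  (boxes `lfunctionZeroBox`, multiplicities `DirichletDisc.zeroOrder`; via `ncard_index_add_ncard_index_eq`);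
* `liCoeffCharRe_inv` — `liCoeffCharRe χ̄ n = liCoeffCharRe χ n` (the zeros of `L(s,χ̄)` are the conjugates of those of
  `L(s,χ)`, with the same multiplicities);
* **`re_liFunctional_log_xiPair_eq`** — the ZERO-SUM IDENTITY for the pair:

    `Re (1/(n−1)!) dⁿ/dsⁿ[s^{n−1} log Ξ_χ(s)]_{s=1} = liCoeffCharRe χ n + liCoeffCharRe χ̄ n = 2·liCoeffCharRe χ n`,

  where `liCoeffCharRe χ n = Σ'_ρ m_χ(ρ) Re[1 − (1 − 1/ρ)ⁿ]` is the tree's (absolutely convergent, RH-free) real Li coefficient of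
  `L(s,χ)` (`LiCriterionDirichlet.lean`).  This is Li 2004, Thm 2 / (2.3) for `ξ(·,χ)` IN REAL PART — the pair `Ξ_χ` has the
  zero multiset `{ρ} ⊎ {ρ̄}` and the Li functional is additive in `log`.  The Taylor-side identification of the left-hand side
  with `2·(charLiTrend χ n + charLiOsc χ n)` (T-D2s `LiDirichletSplit`) is the next (last) file.

## References
* X.-J. Li, Illinois J. Math. 48 (2004) 491–503, Thm 2, (2.3). [Li2004]
* E. Bombieri, J. C. Lagarias, J. Number Theory 77 (1999), Thm 1. [BombieriLagarias1999]
* H. L. Montgomery, R. C. Vaughan, *Multiplicative Number Theory I*, Cor. 10.8. [MontgomeryVaughan2007]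
-/

noncomputable section

open Complex Filter Topology Set Metric
open scoped ComplexConjugate Nat

namespace Literature.NumberTheory.LFunctions

namespace DirichletTheta

open ExplicitPsiChar LiDirichlet

variable {q : ℕ} [NeZero q] {χ : DirichletCharacter ℂ q} {b : ℕ → ℂ}

/-! ### Finiteness of the truncations and cofinality -/

/-- `(ρₙ − ½)² = 9/4 + 1/bₙ`. [folklore] -/
private theorem xiPairZero_sub_half_sq' (b : ℕ → ℂ) (n : ℕ) :
    (xiPairZero b n - 1 / 2) ^ 2 = 9 / 4 + (b n)⁻¹ := by
  rw [xiPairZero, add_sub_cancel_left, Literature.Analysis.Complex.KiKim.cpow_half_sq]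

omit [NeZero q] in
/-- The inverse of a primitive character is primitive. [folklore] -/
private theorem isPrimitive_inv'' (hχ : χ.IsPrimitive) : χ⁻¹.IsPrimitive := by
  rw [DirichletCharacter.isPrimitive_def, DirichletCharacter.conductor_inv]; exact hχ

/-- The Hadamard indices with `|Im ρₖ| ≤ T` form a finite set: for them `‖bₖ‖ = 1/|(ρₖ − ½)² − 9/4| ≥ 1/((|T| + ½)² + 9/4)`,
and `bₖ → 0`. [folklore] -/
private theorem finite_setOf_abs_im_xiPairZero_le (hχ : χ.IsPrimitive) (h1 : χ ≠ 1) (hbs : Summable fun n ↦ ‖b n‖)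
    (hprod : ∀ z : ℂ, HasProd (fun n ↦ 1 - b n * (z ^ 2 - 9 / 4)) (xiPair χ (1 / 2 + z) / xiPair χ 2)) (T : ℝ) :
    {k : ℕ | b k ≠ 0 ∧ |(xiPairZero b k).im| ≤ T}.Finite := by
  have h2 : xiPair χ 2 ≠ 0 := xiPair_two_ne_zero hχ h1
  set ε : ℝ := 1 / ((|T| + 1 / 2) ^ 2 + 9 / 4) with hε
  have hε0 : 0 < ε := by positivity
  have hfin : {k : ℕ | ε ≤ ‖b k‖}.Finite := by
    have ht := (Summable.of_norm hbs).tendsto_cofinite_zero.norm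
    rw [norm_zero] at ht
    have hev : ∀ᶠ k in cofinite, ‖b k‖ < ε := ht.eventually (gt_mem_nhds hε0)
    simpa [Filter.eventually_cofinite, not_lt] using hev
  refine hfin.subset fun k hk ↦ ?_
  obtain ⟨hbk, hT⟩ := hk
  obtain ⟨h0, h1'⟩ := re_mem_Ioo_of_xiPair_eq_zero hχ h1 (xiPair_xiPairZero h2 hprod hbk)
  set ρ := xiPairZero b k with hρ
  have hsq : (ρ - 1 / 2) ^ 2 - 9 / 4 = (b k)⁻¹ := by rw [xiPairZero_sub_half_sq' b k]; ring
  have hb : b k = ((ρ - 1 / 2) ^ 2 - 9 / 4)⁻¹ := by rw [hsq, inv_inv]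
  have hnorm : ‖ρ - 1 / 2‖ ≤ |T| + 1 / 2 := by
    have hre : |(ρ - 1 / 2).re| ≤ 1 / 2 := by
      rw [abs_le]; simp only [sub_re, one_div]; norm_num; constructor <;> linarith
    have him : |(ρ - 1 / 2).im| ≤ |T| := by
      simp only [sub_im, one_div]; norm_num; exact hT.trans (le_abs_self T)
    calc ‖ρ - 1 / 2‖ ≤ |(ρ - 1 / 2).re| + |(ρ - 1 / 2).im| := Complex.norm_le_abs_re_add_abs_im _
      _ ≤ |T| + 1 / 2 := by linarith
  have hden : ‖(ρ - 1 / 2) ^ 2 - 9 / 4‖ ≤ (|T| + 1 / 2) ^ 2 + 9 / 4 := by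
    calc ‖(ρ - 1 / 2) ^ 2 - 9 / 4‖ ≤ ‖(ρ - 1 / 2) ^ 2‖ + ‖(9 / 4 : ℂ)‖ := norm_sub_le _ _
      _ = ‖ρ - 1 / 2‖ ^ 2 + 9 / 4 := by rw [norm_pow]; norm_num
      _ ≤ (|T| + 1 / 2) ^ 2 + 9 / 4 := by gcongr
  have hpos : 0 < ‖(ρ - 1 / 2) ^ 2 - 9 / 4‖ := by
    rw [norm_pos_iff, hsq]; exact inv_ne_zero hbk
  show ε ≤ ‖b k‖
  rw [hb, norm_inv, hε, one_div]
  exact inv_anti₀ hpos hden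

/-- **Cofinality of the truncations**: if `Σₖ Gₖ = D` (unconditionally) and `Gₖ = 0` whenever `bₖ = 0`, the truncated sums
over `{k : bₖ ≠ 0, |Im ρₖ| ≤ T}` tend to `D` as `T → ∞`. [folklore] -/
private theorem tendsto_sum_truncation {G : ℕ → ℂ} {D : ℂ} (hG : HasSum G D) (hG0 : ∀ k, b k = 0 → G k = 0)
    (K : ℝ → Finset ℕ) (hK : ∀ T k, k ∈ K T ↔ b k ≠ 0 ∧ |(xiPairZero b k).im| ≤ T) :
    Tendsto (fun T ↦ ∑ k ∈ K T, G k) atTop (𝓝 D) := by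
  classical
  have hsupp : Function.support G ⊆ {k | b k ≠ 0} := fun k hk hb ↦ hk (hG0 k hb)
  have hG' : HasSum (fun k : {k // b k ≠ 0} ↦ G k) D := (hasSum_subtype_iff_of_support_subset hsupp).2 hG
  let K' : ℝ → Finset {k // b k ≠ 0} := fun T ↦ (K T).subtype fun k ↦ b k ≠ 0
  have hmono : Tendsto K' atTop atTop := by
    refine tendsto_atTop.2 fun s ↦ ?_
    filter_upwards [eventually_ge_atTop (∑ k ∈ s, |(xiPairZero b (k : ℕ)).im|)] with T hT
    intro k hk
    have hle : |(xiPairZero b (k : ℕ)).im| ≤ T :=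
      (Finset.single_le_sum (f := fun k : {k // b k ≠ 0} ↦ |(xiPairZero b (k : ℕ)).im|)
        (fun k _ ↦ abs_nonneg _) hk).trans hT
    show k ∈ (K T).subtype fun k ↦ b k ≠ 0
    rw [Finset.mem_subtype, hK]
    exact ⟨k.2, hle⟩
  have H := hG'.comp hmono
  refine H.congr fun T ↦ ?_
  show ∑ k ∈ (K T).subtype (fun k ↦ b k ≠ 0), G k = ∑ k ∈ K T, G k
  exact Finset.sum_subtype_of_mem (f := G) fun k hk ↦ ((hK T k).1 hk).1

/-! ### Double counting: pairs versus zeros with multiplicity -/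

/-- `Ξ_χ(ρ) = 0` iff `ρ` is a non-trivial zero of `L(s,χ)` or of `L(s,χ̄)`. [cite: MontgomeryVaughan2007, Cor 10.8] -/
private theorem xiPair_eq_zero_iff (hχ : χ.IsPrimitive) (h1 : χ ≠ 1) (ρ : ℂ) :
    xiPair χ ρ = 0 ↔ ρ ∈ charNontrivialZeros χ ∨ ρ ∈ charNontrivialZeros χ⁻¹ := by
  rw [xiPair, mul_eq_zero, dirichletXi_eq_zero_iff_mem_charNontrivialZeros hχ h1,
    dirichletXi_eq_zero_iff_mem_charNontrivialZeros (isPrimitive_inv'' hχ) (inv_ne_one.mpr h1)]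

/-- The box sum of `m_ψ F` over `lfunctionZeroBox ψ T` equals the sum over any finite superset on which the extra points are not
zeros of `L(s, ψ)` (there `m_ψ = 0`). [folklore] -/
private theorem finsum_box_eq_sum {ψ : DirichletCharacter ℂ q} (hψ : ψ ≠ 1) (F : ℂ → ℂ) (T : ℝ) (Z : Finset ℂ)
    (hsub : ∀ ρ ∈ lfunctionZeroBox ψ T, ρ ∈ Z)
    (hzero : ∀ ρ ∈ Z, ρ ∉ lfunctionZeroBox ψ T → ψ.LFunction ρ ≠ 0) :
    ∑ᶠ ρ ∈ lfunctionZeroBox ψ T, (DirichletDisc.zeroOrder ψ ρ : ℂ) * F ρ =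
      ∑ ρ ∈ Z, (DirichletDisc.zeroOrder ψ ρ : ℂ) * F ρ := by
  classical
  rw [finsum_mem_eq_finite_toFinset_sum _ (lfunctionZeroBox_finite hψ T)]
  refine Finset.sum_subset (fun ρ hρ ↦ hsub ρ ((Set.Finite.mem_toFinset _).1 hρ)) fun ρ hρZ hρB ↦ ?_
  have hL : ψ.LFunction ρ ≠ 0 := hzero ρ hρZ (fun h ↦ hρB ((Set.Finite.mem_toFinset _).2 h))
  have hm : DirichletDisc.zeroOrder ψ ρ = 0 := by
    by_contra hne
    exact hL ((DirichletDisc.zeroOrder_pos_iff ψ hψ ρ).1 (Nat.pos_of_ne_zero hne))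
  rw [hm, Nat.cast_zero, zero_mul]

/-- **Double counting.**  For a Hadamard sequence `b` of `Ξ_χ` (with multiplicities), every `T` and every `F`:
`Σ_{k : bₖ ≠ 0, |Im ρₖ| ≤ T} [F(ρₖ) + F(1 − ρₖ)] = Σ_{ρ ∈ box_χ(T)} m_χ(ρ) F(ρ) + Σ_{ρ ∈ box_χ̄(T)} m_χ̄(ρ) F(ρ)` — each zero `ρ`
of `Ξ_χ` with `|Im ρ| ≤ T` is hit `m_χ(ρ) + m_χ̄(ρ)` times by the two families `k ↦ ρₖ`, `k ↦ 1 − ρₖ`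
(`ncard_index_add_ncard_index_eq`). [cite: Li2004, Thm 2] -/
theorem sum_pairs_eq_finsum_add_finsum (hχ : χ.IsPrimitive) (h1 : χ ≠ 1)
    (hmult : ∀ a : ℂ, a ≠ 0 → {n : ℕ | b n = a⁻¹}.ncard = analyticOrderNatAt (fun w ↦ xiPairLift χ (w + 9 / 4)) a)
    (hprod : ∀ z : ℂ, HasProd (fun n ↦ 1 - b n * (z ^ 2 - 9 / 4)) (xiPair χ (1 / 2 + z) / xiPair χ 2))
    (F : ℂ → ℂ) (T : ℝ) (K : Finset ℕ) (hK : ∀ k, k ∈ K ↔ b k ≠ 0 ∧ |(xiPairZero b k).im| ≤ T) :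
    ∑ k ∈ K, (F (xiPairZero b k) + F (1 - xiPairZero b k)) =
      (∑ᶠ ρ ∈ lfunctionZeroBox χ T, (DirichletDisc.zeroOrder χ ρ : ℂ) * F ρ) +
        ∑ᶠ ρ ∈ lfunctionZeroBox χ⁻¹ T, (DirichletDisc.zeroOrder χ⁻¹ ρ : ℂ) * F ρ := by
  classical
  have h2 : xiPair χ 2 ≠ 0 := xiPair_two_ne_zero hχ h1
  have h1' : χ⁻¹ ≠ 1 := inv_ne_one.mpr h1
  -- the finite set `Z` of zeros of `Ξ_χ` with `|Im| ≤ T`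
  set Zs : Set ℂ := lfunctionZeroBox χ T ∪ lfunctionZeroBox χ⁻¹ T with hZs
  have hZfin : Zs.Finite := (lfunctionZeroBox_finite h1 T).union (lfunctionZeroBox_finite h1' T)
  set Z : Finset ℂ := hZfin.toFinset with hZ
  have hmemZ : ∀ ρ, ρ ∈ Z ↔ xiPair χ ρ = 0 ∧ |ρ.im| ≤ T := by
    intro ρ
    rw [hZ, Set.Finite.mem_toFinset, hZs, Set.mem_union, xiPair_eq_zero_iff hχ h1,
      lfunctionZeroBox_eq_inter, lfunctionZeroBox_eq_inter]
    simp only [Set.mem_inter_iff, Set.mem_setOf_eq]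
    tauto
  -- RHS as a sum over `Z`
  have hRχ : ∑ᶠ ρ ∈ lfunctionZeroBox χ T, (DirichletDisc.zeroOrder χ ρ : ℂ) * F ρ =
      ∑ ρ ∈ Z, (DirichletDisc.zeroOrder χ ρ : ℂ) * F ρ := by
    refine finsum_box_eq_sum h1 F T Z (fun ρ hρ ↦ ?_) (fun ρ hρZ hρB hL ↦ hρB ?_)
    · rw [hZ, Set.Finite.mem_toFinset, hZs]; exact Or.inl hρ
    · obtain ⟨hΞ, hT⟩ := (hmemZ ρ).1 hρZ
      obtain ⟨hr0, hr1⟩ := re_mem_Ioo_of_xiPair_eq_zero hχ h1 hΞ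
      exact ⟨hL, hr0, hr1, hT⟩
  have hRχ' : ∑ᶠ ρ ∈ lfunctionZeroBox χ⁻¹ T, (DirichletDisc.zeroOrder χ⁻¹ ρ : ℂ) * F ρ =
      ∑ ρ ∈ Z, (DirichletDisc.zeroOrder χ⁻¹ ρ : ℂ) * F ρ := by
    refine finsum_box_eq_sum h1' F T Z (fun ρ hρ ↦ ?_) (fun ρ hρZ hρB hL ↦ hρB ?_)
    · rw [hZ, Set.Finite.mem_toFinset, hZs]; exact Or.inr hρ
    · obtain ⟨hΞ, hT⟩ := (hmemZ ρ).1 hρZ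
      obtain ⟨hr0, hr1⟩ := re_mem_Ioo_of_xiPair_eq_zero hχ h1 hΞ
      exact ⟨hL, hr0, hr1, hT⟩
  rw [hRχ, hRχ', ← Finset.sum_add_distrib]
  -- LHS, first family `k ↦ ρₖ`
  have hmap1 : ∀ k ∈ K, xiPairZero b k ∈ Z := by
    intro k hk
    obtain ⟨hbk, hT⟩ := (hK k).1 hk
    exact (hmemZ _).2 ⟨xiPair_xiPairZero h2 hprod hbk, hT⟩
  have hmap2 : ∀ k ∈ K, 1 - xiPairZero b k ∈ Z := by
    intro k hk
    obtain ⟨hbk, hT⟩ := (hK k).1 hk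
    refine (hmemZ _).2 ⟨xiPair_one_sub_xiPairZero h2 hprod hbk, ?_⟩
    simpa [abs_neg] using hT
  have hL1 : ∑ k ∈ K, F (xiPairZero b k) =
      ∑ ρ ∈ Z, ((K.filter fun k ↦ xiPairZero b k = ρ).card : ℂ) * F ρ := by
    rw [← Finset.sum_fiberwise_of_maps_to hmap1]
    refine Finset.sum_congr rfl fun ρ _ ↦ ?_
    rw [Finset.sum_congr rfl (fun k hk ↦ by rw [(Finset.mem_filter.1 hk).2] : ∀ k ∈ K.filter
      (fun k ↦ xiPairZero b k = ρ), F (xiPairZero b k) = F ρ), Finset.sum_const, nsmul_eq_mul]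
  have hL2 : ∑ k ∈ K, F (1 - xiPairZero b k) =
      ∑ ρ ∈ Z, ((K.filter fun k ↦ 1 - xiPairZero b k = ρ).card : ℂ) * F ρ := by
    rw [← Finset.sum_fiberwise_of_maps_to hmap2]
    refine Finset.sum_congr rfl fun ρ _ ↦ ?_
    rw [Finset.sum_congr rfl (fun k hk ↦ by rw [(Finset.mem_filter.1 hk).2] : ∀ k ∈ K.filter
      (fun k ↦ 1 - xiPairZero b k = ρ), F (1 - xiPairZero b k) = F ρ), Finset.sum_const, nsmul_eq_mul]
  rw [Finset.sum_add_distrib, hL1, hL2, ← Finset.sum_add_distrib]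
  refine Finset.sum_congr rfl fun ρ hρ ↦ ?_
  obtain ⟨hΞ, hT⟩ := (hmemZ ρ).1 hρ
  -- the two filters are the two index sets of `ncard_index_add_ncard_index_eq`
  have hA : ({k : ℕ | b k ≠ 0 ∧ xiPairZero b k = ρ} : Set ℕ) = ↑(K.filter fun k ↦ xiPairZero b k = ρ) := by
    ext k
    simp only [Set.mem_setOf_eq, Finset.coe_filter, hK]
    constructor
    · rintro ⟨hbk, hk⟩; exact ⟨⟨hbk, by rw [hk]; exact hT⟩, hk⟩
    · rintro ⟨⟨hbk, -⟩, hk⟩; exact ⟨hbk, hk⟩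
  have hB : ({k : ℕ | b k ≠ 0 ∧ 1 - xiPairZero b k = ρ} : Set ℕ) = ↑(K.filter fun k ↦ 1 - xiPairZero b k = ρ) := by
    ext k
    simp only [Set.mem_setOf_eq, Finset.coe_filter, hK]
    constructor
    · rintro ⟨hbk, hk⟩
      refine ⟨⟨hbk, ?_⟩, hk⟩
      have : (xiPairZero b k).im = -ρ.im := by rw [← hk]; simp
      rw [this, abs_neg]; exact hT
    · rintro ⟨⟨hbk, -⟩, hk⟩; exact ⟨hbk, hk⟩
  have hcount := ncard_index_add_ncard_index_eq hχ h1 hmult hΞ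
  rw [hA, hB, Set.ncard_coe_finset, Set.ncard_coe_finset] at hcount
  rw [← add_mul, ← Nat.cast_add, hcount, Nat.cast_add, add_mul]

/-! ### The real Li coefficient is the same for `χ` and `χ̄` -/

/-- `liCoeffCharRe χ̄ n = liCoeffCharRe χ n`: the non-trivial zeros of `L(s, χ̄)` are the complex conjugates of those of
`L(s, χ)` (`conj L(s̄, χ) = L(s, χ̄)`), with the same multiplicities (`WeilConverseChar.zeroOrder_inv_conj`), and
`Re[1 − (1 − 1/ρ̄)ⁿ] = Re[1 − (1 − 1/ρ)ⁿ]`. [cite: MontgomeryVaughan2007, Cor 10.8] -/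
theorem liCoeffCharRe_inv (h1 : χ ≠ 1) (n : ℕ) : liCoeffCharRe χ⁻¹ n = liCoeffCharRe χ n := by
  have h1' : χ⁻¹ ≠ 1 := inv_ne_one.mpr h1
  have hmem : ∀ {ψ : DirichletCharacter ℂ q}, ψ ≠ 1 → ∀ {ρ : ℂ}, ρ ∈ charNontrivialZeros ψ →
      conj ρ ∈ charNontrivialZeros ψ⁻¹ := by
    intro ψ hψ ρ hρ
    obtain ⟨hL, h0, h1⟩ := hρ
    refine ⟨?_, by simpa using h0, by simpa using h1⟩
    rw [← DirichletZFR.conj_LFunction_conj ψ hψ, Complex.conj_conj, hL, map_zero]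
  let e : charNontrivialZeros χ ≃ charNontrivialZeros χ⁻¹ :=
    { toFun := fun ρ ↦ ⟨conj (ρ : ℂ), hmem h1 ρ.2⟩
      invFun := fun ρ ↦ ⟨conj (ρ : ℂ), by simpa using hmem h1' ρ.2⟩
      left_inv := fun ρ ↦ by simp
      right_inv := fun ρ ↦ by simp }
  unfold liCoeffCharRe
  rw [← e.tsum_eq]
  refine tsum_congr fun ρ ↦ ?_
  have hm : DirichletDisc.zeroOrder χ⁻¹ (conj (ρ : ℂ)) = DirichletDisc.zeroOrder χ (ρ : ℂ) :=
    WeilConverseChar.zeroOrder_inv_conj h1 _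
  have hre : (1 - (1 - 1 / conj (ρ : ℂ)) ^ n).re = (1 - (1 - 1 / (ρ : ℂ)) ^ n).re := by
    have : (1 - (1 - 1 / conj (ρ : ℂ)) ^ n) = conj (1 - (1 - 1 / (ρ : ℂ)) ^ n) := by
      rw [map_sub, map_one, map_pow, map_sub, map_one, map_div₀, map_one]
    rw [this, Complex.conj_re]
  show (DirichletDisc.zeroOrder χ⁻¹ (conj (ρ : ℂ)) : ℝ) * (1 - (1 - 1 / conj (ρ : ℂ)) ^ n).re =
    (DirichletDisc.zeroOrder χ (ρ : ℂ) : ℝ) * (1 - (1 - 1 / (ρ : ℂ)) ^ n).re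
  rw [hm, hre]

/-! ### The zero-sum identity -/

/-- **The zero-sum identity for the pair** (Li 2004, Thm 2 / (2.3), in real part; Bombieri–Lagarias 1999 Thm 1 for the
multiset `{ρ} ⊎ {ρ̄}`): for a primitive `χ` mod `q > 1` and `n ≥ 1`,

  `Re (1/(n−1)!) dⁿ/dsⁿ[ s^{n−1} log Ξ_χ(s) ]_{s=1} = liCoeffCharRe χ n + liCoeffCharRe χ̄ n`,

`Ξ_χ = ξ(·,χ)ξ(·,χ̄)`.  Proof: the Hadamard product of `Ξ_χ` (genus zero in `(s−½)²`, base point `9/4`) gives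
`(1/(n−1)!) dⁿ/dsⁿ[s^{n−1} log Ξ_χ]_{s=1} = Σₖ ([1−(1−1/ρₖ)ⁿ] + [1−(1−1/(1−ρₖ))ⁿ])` (`hasSum_li_pairs`); its truncations at
`|Im ρₖ| ≤ T` are the box partial sums of `χ` plus those of `χ̄` (`sum_pairs_eq_finsum_add_finsum`), whose real parts tend to
`liCoeffCharRe χ n`, `liCoeffCharRe χ̄ n` (`LiDirichlet.tendsto_re_liPartialSum`). [cite: Li2004, Thm 2] -/
theorem re_liFunctional_log_xiPair_eq (hχ : χ.IsPrimitive) (hq : 1 < q) {n : ℕ} (hn : 1 ≤ n) :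
    (iteratedDeriv n (fun s : ℂ ↦ s ^ (n - 1) * Complex.log (xiPair χ s)) 1 / ((n - 1)! : ℂ)).re =
      liCoeffCharRe χ n + liCoeffCharRe χ⁻¹ n := by
  classical
  have h1 : χ ≠ 1 := ne_one_of_isPrimitive hχ hq
  have hχ' : χ⁻¹.IsPrimitive := isPrimitive_inv'' hχ
  obtain ⟨b, hbs, -, hmult, hprod⟩ := exists_xiPair_hadamardSeq hχ h1
  set D : ℂ := iteratedDeriv n (fun s : ℂ ↦ s ^ (n - 1) * Complex.log (xiPair χ s)) 1 / ((n - 1)! : ℂ) with hD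
  set f : ℂ → ℂ := fun ρ ↦ 1 - (1 - 1 / ρ) ^ n with hf
  set G : ℕ → ℂ := fun k ↦ if b k = 0 then 0 else f (xiPairZero b k) + f (1 - xiPairZero b k) with hG
  have hGD : HasSum G D := hasSum_li_pairs hχ h1 hbs hprod hn
  set K : ℝ → Finset ℕ := fun T ↦ (finite_setOf_abs_im_xiPairZero_le hχ h1 hbs hprod T).toFinset with hKdef
  have hK : ∀ T k, k ∈ K T ↔ b k ≠ 0 ∧ |(xiPairZero b k).im| ≤ T := fun T k ↦ by
    simp [hKdef, Set.Finite.mem_toFinset]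
  have hlim : Tendsto (fun T ↦ ∑ k ∈ K T, G k) atTop (𝓝 D) :=
    tendsto_sum_truncation hGD (fun k hk ↦ by simp [hG, hk]) K hK
  set A : ℝ → ℂ := fun T ↦ ∑ᶠ ρ ∈ lfunctionZeroBox χ T, (DirichletDisc.zeroOrder χ ρ : ℂ) * f ρ with hA
  set B : ℝ → ℂ := fun T ↦ ∑ᶠ ρ ∈ lfunctionZeroBox χ⁻¹ T, (DirichletDisc.zeroOrder χ⁻¹ ρ : ℂ) * f ρ with hB
  have heq : ∀ T, ∑ k ∈ K T, G k = A T + B T := by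
    intro T
    rw [← sum_pairs_eq_finsum_add_finsum hχ h1 hmult hprod f T (K T) (hK T)]
    refine Finset.sum_congr rfl fun k hk ↦ ?_
    simp [hG, ((hK T k).1 hk).1]
  have hlim' : Tendsto (fun T ↦ A T + B T) atTop (𝓝 D) := by
    simpa only [heq] using hlim
  have hreA : Tendsto (fun T ↦ (A T).re) atTop (𝓝 (liCoeffCharRe χ n)) := by
    have h := tendsto_re_liPartialSum hχ hq n
    refine h.congr fun T ↦ ?_
    simp only [hA, hf]
  have hreB : Tendsto (fun T ↦ (B T).re) atTop (𝓝 (liCoeffCharRe χ⁻¹ n)) := by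
    have h := tendsto_re_liPartialSum hχ' hq n
    refine h.congr fun T ↦ ?_
    simp only [hB, hf]
  have hre : Tendsto (fun T ↦ (A T + B T).re) atTop (𝓝 (liCoeffCharRe χ n + liCoeffCharRe χ⁻¹ n)) := by
    simpa only [Complex.add_re] using hreA.add hreB
  have hre' : Tendsto (fun T ↦ (A T + B T).re) atTop (𝓝 D.re) := (Complex.continuous_re.tendsto D).comp hlim'
  exact tendsto_nhds_unique hre' hre

/-- **Corollary**: `Re (1/(n−1)!) dⁿ/dsⁿ[s^{n−1} log Ξ_χ(s)]_{s=1} = 2·liCoeffCharRe χ n` (primitive `χ` mod `q > 1`, `n ≥ 1`).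
[cite: Li2004, Thm 2] -/
theorem re_liFunctional_log_xiPair_eq_two_mul (hχ : χ.IsPrimitive) (hq : 1 < q) {n : ℕ} (hn : 1 ≤ n) :
    (iteratedDeriv n (fun s : ℂ ↦ s ^ (n - 1) * Complex.log (xiPair χ s)) 1 / ((n - 1)! : ℂ)).re =
      2 * liCoeffCharRe χ n := by
  rw [re_liFunctional_log_xiPair_eq hχ hq hn, liCoeffCharRe_inv (ne_one_of_isPrimitive hχ hq), two_mul]

end DirichletTheta

end Literature.NumberTheory.LFunctions

end
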